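import Literature.AlgebraicGeometry.HodgeTheory.PeriodIntegralVariation
import Literature.Analysis.Complex.PQTypesWedgeVanishing
import Literature.Analysis.Complex.ContractionPQTypes
import HarnessLib

/-!
# Holomorphy of period-type integrals: `∂̄ ∫_M φ^*β ∧ Ψ_p^* Ξ = 0`

Topic: Hodge theory in families — the type-theoretic heart of Griffiths' theorem on the holomorphy
of the Hodge bundles `F^p H^k(X_t)` (Voisin (2002), §10.2.2, proof of Thm. 10.9;
Carlson–Müller-Stach–Peters (2017), §5.3). Theorems only, no new facts.

Setting. `π : T → P` is a family over an open set of a finite-dimensional complex normed space `P`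
(total space `T` a manifold modelled on a complex normed space `E_T`), trivialised differentiably
by `Ψ : P → M → T`, `π (Ψ p x) = p` (`M` a fixed compact oriented manifold, `Ψ` jointly smooth on
`U × M`); the fibre over `t` is the image of a manifold `X` (modelled on the complex space `E_X`,
`dim_ℝ E_X = dim M`) under `ι : X → T`, `Ψ t = ι ∘ φ` for a smooth `φ : M → X`; the differentials
of `ι` and of `π` along the fibre are `ℂ`-linear (holomorphy read on tangent spaces) and the
fibre is *vertical*: `ker dπ ⊆ im dι` along `Ψ t`. Let `Ξ` be a smooth complex `(k+1)`-form on
`T` with `ι^*Ξ = 0` whose differential `dΞ` lies in `F^{p₀}` along the fibre (every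
`(r,s)`-component with `r < p₀` vanishes), and `β` a smooth closed `l`-form on `X` in `F^{n-p₀+1}`,
`n = dim_ℂ E_X`. Then
`G(p) = ∫_M φ^*β ∧ Ψ_p^* Ξ`
is **complex differentiable at `t`** (`differentiableAt_complex_cintegral_wedge_pullback_family`).

Proof. By `hasFDerivAt_cintegral_wedge_pullback_family`,
`∂_h G(t) = ∫_M φ^*β ∧ Ψ_t^*(ι_{Y_h} dΞ)` with `Y_h = ∂_p Ψ(·, x)(t) h`. Since `π ∘ Ψ(·, x) = id`,
`dπ (Y_h) = h`, so `W = Y_{ih} - i Y_h` is vertical, `W = dι(w)`; hence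
`ι_{Y_{ih}} dΞ = ι_{iY_h} dΞ + ι_{dι w} dΞ` and, pulled back by `dΨ_t = dι ∘ dφ`, the second term is
`φ^*(ι_w ι^* dΞ) = φ^*(ι_w d(ι^*Ξ)) = 0`. For the first,
`ι_{iY} dΞ - i ι_Y dΞ = -i (ι_Y + i ι_{iY}) dΞ` and the antilinear contraction `ι_Y + i ι_{iY}`
preserves `F^{p₀}` (`typeProjAt_curryLeft_add_I_smul_curryLeft_eq_zero_of_lt`); pulled back by
the `ℂ`-linear `dι` it stays in `F^{p₀}`, and `β ∧ F^{p₀} = 0` pointwise on `X`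
(`wedge_eq_zero_of_typeProjAt_eq_zero`, first type index `> n`). So `∂_{ih} G = i ∂_h G`: the real
derivative is `ℂ`-linear. In Voisin's proof this is the statement that `∂Ω/∂t̄` restricted to the
fibre stays in `F^pA^k(X_t)` because `∂/∂t̄`-type vectors contract `F^p` into `F^p`.

## References

* C. Voisin, *Hodge Theory and Complex Algebraic Geometry I*, CUP (2002), §10.2.2, proof of
  Thm. 10.9; §7.1.2. [VoisinHodgeI2002]
* J. Carlson, S. Müller-Stach, C. Peters, *Period Mappings and Period Domains*, 2nd ed. (2017),
  §5.3. [CarlsonMullerStachPeters2017]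
* P. Griffiths, Periods of integrals on algebraic manifolds II, Amer. J. Math. 90 (1968),
  Thm. 1.1. [Griffiths1968]
-/

noncomputable section

open scoped Manifold ContDiff Topology
open Bundle Set Function Filter Module Complex
open Literature.Geometry.Kaehler Literature.NumberTheory.Transcendental
open Literature.AlgebraicGeometry.Motives Literature.Analysis.Complex

namespace Literature.AlgebraicGeometry.HodgeTheory

-- The identification `TangentSpace I x = E` is an abuse of definitional equality; as in the
-- tree's form files we let `isDefEq` unfold it.
set_option backward.isDefEq.respectTransparency false

variable {EM : Type*} [NormedAddCommGroup EM] [NormedSpace ℂ EM] [FiniteDimensional ℂ EM]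
  [MeasurableSpace EM] [BorelSpace EM] {N : ℕ} [Fact (finrank ℝ EM = N)]
  {M : Type*} [TopologicalSpace M] [ChartedSpace EM M] [IsManifold 𝓘(ℝ, EM) ∞ M]
  [T2Space M] [CompactSpace M]
  {o : (x : M) → Orientation ℝ (TangentSpace 𝓘(ℝ, EM) x) (Fin N)}
  {ET : Type*} [NormedAddCommGroup ET] [NormedSpace ℂ ET]
  {T : Type*} [TopologicalSpace T] [ChartedSpace ET T] [IsManifold 𝓘(ℝ, ET) ∞ T]
  {EX : Type*} [NormedAddCommGroup EX] [NormedSpace ℂ EX] [FiniteDimensional ℂ EX]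
  {X : Type*} [TopologicalSpace X] [ChartedSpace EX X] [IsManifold 𝓘(ℝ, EX) ∞ X]
  {P : Type*} [NormedAddCommGroup P] [NormedSpace ℂ P] [FiniteDimensional ℂ P]

/-! ### Real-linear maps commuting with `i` -/

section Linear

variable {V W : Type*} [AddCommGroup V] [Module ℂ V] [AddCommGroup W] [Module ℂ W]

/-- A real-linear map between complex vector spaces commuting with `i` is `ℂ`-linear
(`c • u = Re c • u + Im c • (i u)`, the tree's `complex_smul_eq_re_smul_add_im_smul_I_smul`).
[folklore] -/
theorem map_complex_smul_of_map_I_smul (f : V →ₗ[ℝ] W) (hf : ∀ v, f (I • v) = I • f v)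
    (c : ℂ) (v : V) : f (c • v) = c • f v := by
  rw [complex_smul_eq_re_smul_add_im_smul_I_smul c v, Complex.coe_smul, Complex.coe_smul,
    map_add, f.map_smul, f.map_smul, hf, complex_smul_eq_re_smul_add_im_smul_I_smul c (f v),
    Complex.coe_smul, Complex.coe_smul]

end Linear

omit [FiniteDimensional ℂ P] in
/-- A continuous real-linear functional `L : P → ℂ` on a complex normed space with
`L (i h) = i L h` is the restriction of scalars of a continuous complex-linear functional.
[folklore] -/
theorem exists_restrictScalars_eq_of_map_I_smul (L : P →L[ℝ] ℂ)
    (hL : ∀ h, L (I • h) = I * L h) : ∃ g : P →L[ℂ] ℂ, g.restrictScalars ℝ = L := by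
  have hL' : ∀ (c : ℂ) (h : P), L (c • h) = c • L h := fun c h ↦
    map_complex_smul_of_map_I_smul (L : P →ₗ[ℝ] ℂ) (fun h ↦ by
      rw [ContinuousLinearMap.coe_coe, hL, smul_eq_mul]) c h
  let g : P →ₗ[ℂ] ℂ := ⟨⟨L, L.map_add⟩, fun c h ↦ by rw [RingHom.id_apply]; exact hL' c h⟩
  exact ⟨⟨g, L.continuous⟩, by ext h; rfl⟩

omit [FiniteDimensional ℂ P] in
/-- A function into `ℂ` with a real derivative commuting with `i` is complex differentiable.
[folklore] -/
theorem differentiableAt_complex_of_hasFDerivAt_of_map_I_smul {G : P → ℂ} {L : P →L[ℝ] ℂ}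
    {t : P} (hG : HasFDerivAt G L t) (hL : ∀ h, L (I • h) = I * L h) :
    DifferentiableAt ℂ G t := by
  obtain ⟨g, hg⟩ := exists_restrictScalars_eq_of_map_I_smul L hL
  exact (differentiableAt_iff_restrictScalars ℝ hG.differentiableAt).2 ⟨g, by rw [hg, hG.fderiv]⟩

/-- `ℂ`-scalars pass through precomposition of `ℂ`-valued alternating maps. [folklore] -/
theorem complex_smul_compContinuousLinearMap {V W : Type*} [NormedAddCommGroup V]
    [NormedSpace ℝ V] [NormedAddCommGroup W] [NormedSpace ℝ W] {m : ℕ} (c : ℂ)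
    (η : W [⋀^Fin m]→L[ℝ] ℂ) (f : V →L[ℝ] W) :
    (c • η).compContinuousLinearMap f = c • η.compContinuousLinearMap f := by
  ext v
  simp [ContinuousAlternatingMap.compContinuousLinearMap_apply]

/-- Precomposition of the zero alternating map is zero. [folklore] -/
theorem zero_compContinuousLinearMap' {V W : Type*} [NormedAddCommGroup V] [NormedSpace ℝ V]
    [NormedAddCommGroup W] [NormedSpace ℝ W] {m : ℕ} (f : V →L[ℝ] W) :
    (0 : W [⋀^Fin m]→L[ℝ] ℂ).compContinuousLinearMap f = 0 := by
  ext v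
  simp [ContinuousAlternatingMap.compContinuousLinearMap_apply]

/-! ### The main theorem -/

set_option maxHeartbeats 400000 in
/-- **Holomorphy of period-type integrals** (the type-theoretic heart of Griffiths' theorem,
Voisin (2002), proof of Thm. 10.9; see the module docstring for the setting and the proof). Data:
a compact oriented `M` (continuous orientation family), a family `Ψ : P → M → T` jointly smooth
on `U × M` (`U ∋ t` open) with `π ∘ Ψ p = p` on `U`, `dπ` differentiable and `ℂ`-linear along
`Ψ t`; the fibre presented as `Ψ t = ι ∘ φ` with `ι : X → T` smooth with `ℂ`-linear differential,
`φ : M → X` smooth, and verticality `ker dπ_{Ψ t x} ⊆ im dι_{φ x}`; a smooth `(k+1)`-form `Ξ` on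
`T` with `ι^*Ξ = 0` and `dΞ ∈ F^{p₀}` along the fibre; a smooth closed `l`-form `β` on `X` in
`F^{n - p₀ + 1}`, `n = dim_ℂ E_X`, `dim_ℝ E_X = dim M = l + (k + 1)`. Conclusion:
`p ↦ ∫_M φ^*β ∧ Ψ_p^*Ξ` is complex differentiable at `t`.
[cite: VoisinHodgeI2002, §10.2.2 (proof of Thm. 10.9)] -/
theorem differentiableAt_complex_cintegral_wedge_pullback_family (ho : IsContinuousOrientation o)
    {Ψ : P → M → T} {U : Set P} (hU : IsOpen U) {t : P} (ht : t ∈ U)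
    (hΨ : ∀ p ∈ U, ∀ x, ContMDiffAt (𝓘(ℝ, P).prod 𝓘(ℝ, EM)) 𝓘(ℝ, ET) ∞ (uncurry Ψ) (p, x))
    {proj : T → P} (hπΨ : ∀ p ∈ U, ∀ x, proj (Ψ p x) = p)
    (hπd : ∀ x, MDifferentiableAt 𝓘(ℝ, ET) 𝓘(ℝ, P) proj (Ψ t x))
    (hπℂ : ∀ x (v : ET), mfderiv 𝓘(ℝ, ET) 𝓘(ℝ, P) proj (Ψ t x) (I • v) =
      I • (show P from mfderiv 𝓘(ℝ, ET) 𝓘(ℝ, P) proj (Ψ t x) v))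
    {ι : X → T} {φ : M → X} (hιφ : ι ∘ φ = Ψ t)
    (hι : ContMDiff 𝓘(ℝ, EX) 𝓘(ℝ, ET) ∞ ι) (hφ : ContMDiff 𝓘(ℝ, EM) 𝓘(ℝ, EX) ∞ φ)
    (hιℂ : ∀ y (v : EX), mfderiv 𝓘(ℝ, EX) 𝓘(ℝ, ET) ι y (I • v) =
      I • (show ET from mfderiv 𝓘(ℝ, EX) 𝓘(ℝ, ET) ι y v))
    (hvert : ∀ x (w : ET), mfderiv 𝓘(ℝ, ET) 𝓘(ℝ, P) proj (Ψ t x) w = 0 →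
      ∃ w' : EX, mfderiv 𝓘(ℝ, EX) 𝓘(ℝ, ET) ι (φ x) w' = w)
    {k l : ℕ} (hkl : l + (k + 1) = N) (hXN : finrank ℝ EX = N) {p₀ : ℕ}
    {Ξ : MForm 𝓘(ℝ, ET) T ℂ (k + 1)} (hΞ : IsSmoothForm Ξ)
    (hΞι : Ξ.pullback 𝓘(ℝ, EX) ι = 0)
    (hdΞ : ∀ x r s, r < p₀ →
      typeProjAt r s (show ET [⋀^Fin (k + 1 + 1)]→L[ℝ] ℂ from mextDeriv Ξ (Ψ t x)) = 0)
    {β : MForm 𝓘(ℝ, EX) X ℂ l} (hβ : IsSmoothForm β) (hβc : IsClosedForm β)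
    (hβF : ∀ y a b, a + p₀ ≤ finrank ℂ EX →
      typeProjAt a b (show EX [⋀^Fin l]→L[ℝ] ℂ from β y) = 0) :
    DifferentiableAt ℂ (fun p ↦ cintegral o
      (((β.pullback 𝓘(ℝ, EM) φ).wedge (Ξ.pullback 𝓘(ℝ, EM) (Ψ p))).castDeg hkl)) t := by
  subst hkl
  haveI : WedgeFacts 𝓘(ℝ, EM) M ℂ := wedgeFacts_discharged _ _ ℂ
  -- the pulled-back form `γ = φ^*β` is smooth and closed
  set γ : MForm 𝓘(ℝ, EM) M ℂ l := β.pullback 𝓘(ℝ, EM) φ with hγdef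
  have hγ : IsSmoothForm γ := isSmoothForm_pullback hφ hβ
  have hγc : IsClosedForm γ := by
    change mextDeriv γ = 0
    rw [hγdef, mextDeriv_pullback hφ hβ, show mextDeriv β = 0 from hβc, MForm.pullback_zero]
  -- the real derivative
  obtain ⟨G', hG', hG'h⟩ := hasFDerivAt_cintegral_wedge_pullback_family (IT := 𝓘(ℝ, ET)) ho hU
    ht hΨ rfl hΞ hγ hγc
  refine differentiableAt_complex_of_hasFDerivAt_of_map_I_smul hG' fun h ↦ ?_
  -- notation: the contraction form `A v = Ψ_t^*(ι_{Y_v} dΞ)`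
  set A : P → MForm 𝓘(ℝ, EM) M ℂ (k + 1) := fun v x ↦
    letI b : ET [⋀^Fin (k + 1 + 1)]→L[ℝ] ℂ := mextDeriv Ξ (Ψ t x);
    (b.curryLeft (mfderiv 𝓘(ℝ, P) 𝓘(ℝ, ET) (fun p ↦ Ψ p x) t v)).compContinuousLinearMap
      (mfderiv 𝓘(ℝ, EM) 𝓘(ℝ, ET) (Ψ t) x) with hA
  have hG'A : ∀ v, G' v = cintegral o (γ.wedge (A v)) := fun v ↦ hG'h v
  -- smoothness of `A v` (for the linearity of `∫`)
  have hΨev : ∀ x, ∀ᶠ q in 𝓝 (t, x),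
      ContMDiffAt (𝓘(ℝ, P).prod 𝓘(ℝ, EM)) 𝓘(ℝ, ET) ∞ (uncurry Ψ) q := by
    intro x
    have h1 : ∀ᶠ q : P × M in 𝓝 (t, x), q.1 ∈ U :=
      continuousAt_fst.preimage_mem_nhds (hU.mem_nhds ht)
    exact h1.mono fun q hq ↦ hΨ q.1 hq q.2
  have hdΞs : IsSmoothForm (mextDeriv Ξ) := isSmoothForm_mextDeriv (inChart_mextDeriv_holds _ _ _) hΞ
  have hAs : ∀ v, IsSmoothForm (A v) := fun v x ↦
    smoothAt_contraction_family (I := 𝓘(ℝ, EM)) (I' := 𝓘(ℝ, ET)) hdΞs v (hΨev x)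
  -- KEY: `γ ∧ A (i h) = i (γ ∧ A h)` pointwise
  have hkey : γ.wedge (A (I • h)) = I • γ.wedge (A h) := by
    funext x
    -- the players at the point `x`
    obtain ⟨hmd, hmdP⟩ := mdifferentiableAt_slices_of_contMDiffAt (hΨev x).self_of_nhds
    set D : EM →L[ℝ] ET := mfderiv 𝓘(ℝ, EM) 𝓘(ℝ, ET) (Ψ t) x with hD
    set Y : P →L[ℝ] ET := mfderiv 𝓘(ℝ, P) 𝓘(ℝ, ET) (fun p ↦ Ψ p x) t with hY
    set Dι : EX →L[ℝ] ET := mfderiv 𝓘(ℝ, EX) 𝓘(ℝ, ET) ι (φ x) with hDι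
    set Dφ : EM →L[ℝ] EX := mfderiv 𝓘(ℝ, EM) 𝓘(ℝ, EX) φ x with hDφ
    set d : ET [⋀^Fin (k + 1 + 1)]→L[ℝ] ℂ := mextDeriv Ξ (Ψ t x) with hd
    have hιφx : ι (φ x) = Ψ t x := congr_fun hιφ x
    -- (1) `dπ ∘ Y = id`
    have hπY : ∀ v, mfderiv 𝓘(ℝ, ET) 𝓘(ℝ, P) proj (Ψ t x) (Y v) = v := by
      intro v
      have hev : (proj ∘ fun p ↦ Ψ p x) =ᶠ[𝓝 t] id :=
        Filter.eventually_of_mem (hU.mem_nhds ht) fun p hp ↦ hπΨ p hp x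
      have hcomp : mfderiv 𝓘(ℝ, P) 𝓘(ℝ, P) (proj ∘ fun p ↦ Ψ p x) t =
          (mfderiv 𝓘(ℝ, ET) 𝓘(ℝ, P) proj (Ψ t x)).comp Y := mfderiv_comp t (hπd x) hmdP
      have hid : mfderiv 𝓘(ℝ, P) 𝓘(ℝ, P) (proj ∘ fun p ↦ Ψ p x) t = ContinuousLinearMap.id ℝ P := by
        rw [hev.mfderiv_eq, mfderiv_id]
        rfl
      have h3 := ContinuousLinearMap.ext_iff.1 (hcomp.symm.trans hid) v
      exact h3
    -- (2) the vertical vector `W = Y (i h) - i Y h = dι w`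
    obtain ⟨w, hw⟩ : ∃ w : EX, Dι w = Y (I • h) - I • Y h := by
      have h0 : mfderiv 𝓘(ℝ, ET) 𝓘(ℝ, P) proj (Ψ t x) (Y (I • h) - I • Y h) = 0 := by
        rw [map_sub, hπℂ, hπY, hπY, sub_self]
      obtain ⟨w, hw⟩ := hvert x _ h0
      exact ⟨w, hw⟩
    -- (3) `dΨ_t = dι ∘ dφ`
    have hDcomp : D = Dι.comp Dφ := by
      rw [hD, ← hιφ]
      exact mfderiv_comp x (hι.mdifferentiableAt (by simp)) (hφ.mdifferentiableAt (by simp))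
    -- (4) `ι^* dΞ = 0` at `φ x`
    have hdι : d.compContinuousLinearMap Dι = 0 := by
      have h1 : mextDeriv (Ξ.pullback 𝓘(ℝ, EX) ι) = (mextDeriv Ξ).pullback 𝓘(ℝ, EX) ι :=
        mextDeriv_pullback hι hΞ
      rw [hΞι, mextDeriv_zero] at h1
      have h2 := congr_fun h1 (φ x)
      rw [hd, hDι, ← hιφx]
      exact h2.symm
    -- `dι` is `ℂ`-linear
    have hDιℂ : ∀ (c : ℂ) (v : EX), Dι (c • v) = c • Dι v := fun c v ↦
      map_complex_smul_of_map_I_smul (Dι : EX →ₗ[ℝ] ET) (fun v ↦ hιℂ (φ x) v) c v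
    -- (5) algebra of the contraction: `A (i h) x = (ι_{i Y h} dΞ) ∘ dΨ_t`
    have hAI : (A (I • h)) x = (d.curryLeft (I • Y h)).compContinuousLinearMap D := by
      change (d.curryLeft (Y (I • h))).compContinuousLinearMap D = _
      have hsplit : Y (I • h) = I • Y h + Dι w := by rw [hw]; abel
      rw [hsplit, map_add, Literature.Analysis.Calculus.add_compContinuousLinearMap', hDcomp,
        ← Literature.Analysis.Calculus.compContinuousLinearMap_compContinuousLinearMap
          (d.curryLeft (Dι w)),
        ← ContinuousAlternatingMap.curryLeft_compContinuousLinearMap, hdι]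
      simp [zero_compContinuousLinearMap']
    have hAh : (A h) x = (d.curryLeft (Y h)).compContinuousLinearMap D := rfl
    -- (6) the antilinear contraction stays in `F^{p₀}`, and `β ∧ F^{p₀} = 0` on `X`
    set B : ET [⋀^Fin (k + 1)]→L[ℝ] ℂ := d.curryLeft (Y h) + I • d.curryLeft (I • Y h) with hB
    have hBF : ∀ r s, r < p₀ → typeProjAt r s B = 0 := fun r s hr ↦
      typeProjAt_curryLeft_add_I_smul_curryLeft_eq_zero_of_lt (hdΞ x) (Y h) hr
    have hBιF : ∀ r s, r < p₀ → typeProjAt r s (B.compContinuousLinearMap Dι) = 0 := by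
      intro r s hr
      rw [typeProjAt_compContinuousLinearMap _ _ _ _ hDιℂ, hBF r s hr,
        zero_compContinuousLinearMap']
    have hvanish : (show EX [⋀^Fin l]→L[ℝ] ℂ from β (φ x)).wedge
        (B.compContinuousLinearMap Dι) = 0 :=
      wedge_eq_zero_of_typeProjAt_eq_zero (hβF (φ x)) hBιF
    -- (7) conclusion at `x`
    set γx : EM [⋀^Fin l]→L[ℝ] ℂ := γ x with hγx
    have hγβ : γx = (show EX [⋀^Fin l]→L[ℝ] ℂ from β (φ x)).compContinuousLinearMap Dφ := rfl
    have hsplit : d.curryLeft (I • Y h) = I • d.curryLeft (Y h) + (-I) • B := by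
      rw [hB, smul_add, smul_smul, neg_mul, Complex.I_mul_I, neg_neg, one_smul, neg_smul]
      abel
    have hzero : γx.wedge (B.compContinuousLinearMap D) = 0 := by
      rw [hDcomp, ← Literature.Analysis.Calculus.compContinuousLinearMap_compContinuousLinearMap,
        hγβ, ← ContinuousAlternatingMap.wedge_compContinuousLinearMap, hvanish,
        zero_compContinuousLinearMap']
    change γx.wedge ((A (I • h)) x) = I • γx.wedge ((A h) x)
    rw [hAI, hAh, hsplit, Literature.Analysis.Calculus.add_compContinuousLinearMap',
      complex_smul_compContinuousLinearMap, complex_smul_compContinuousLinearMap,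
      ContinuousAlternatingMap.wedge_add_right, wedge_smul_right_complex,
      wedge_smul_right_complex, hzero]
    have h0 : (-I) • (0 : EM [⋀^Fin (l + (k + 1))]→L[ℝ] ℂ) = 0 :=
      @smul_zero ℂ (EM [⋀^Fin (l + (k + 1))]→L[ℝ] ℂ) _ _ (-I)
    exact (congrArg (fun z ↦ I • γx.wedge ((d.curryLeft (Y h)).compContinuousLinearMap D) + z)
      h0).trans (add_zero _)
  -- integrate
  rw [hG'A, hG'A, hkey, HodgeRiemannDegreeOne.cintegral_smul' o ho I (isSmoothForm_wedge hγ (hAs h))]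

end Literature.AlgebraicGeometry.HodgeTheory
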